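import Summits.CriticalPhenomena.SAWScalingLimit.Theorems.SAWDevelopingMapHexConjectureReflexWedgeGeometry
import Summits.CriticalPhenomena.SAWScalingLimit.Theorems.SAWDevelopingMapHexConjectureReflexFluxLine
import Summits.CriticalPhenomena.SAWScalingLimit.Theorems.SAWDevelopingMapHexConjectureConeExteriorEscape
import Summits.CriticalPhenomena.SAWScalingLimit.Theorems.SAWDevelopingMapHexConjectureReflexCellCeilingRays
import Summits.CriticalPhenomena.SAWScalingLimit.Theorems.SAWDevelopingMapHexConjectureArcPhases

/-!
# The dimensionless marginal cell of the critical hexagonal SAW (line `marginal-reflex-wedge-cauchy-kernel`, crux `HexConjecture`)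

Support file for the crux `HexConjecture` (stmt-CriticalPhenomena-0808, Duminil-Copin–Smirnov 2012 Conjecture 1),
lead prover of the line `marginal-reflex-wedge-cauchy-kernel`. This file only ASSEMBLES the landed stubs of the line into
its two unconditional headline theorems about the truncated `300°` lattice wedge `W_N` (`IsReflexWedgeTruncation Λ N`,
objects of `…MarginalWedgeDefs.lean`) rooted at the corner mid-edge `a = cornerEdge`, at `x = x_c`:

* **`marginalCell_arcMass_mem_Icc`** — for every `N ≥ 1`,
  `cos(π/8) ≤ Σ_{arc darts of W_N} Z_{W_N}(a → z) ≤ 1 + √2`: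
  the corner-to-arc `x_c`-mass is SCALE-FREE, two-sided (lower bound: the cone-exterior escape floor
  `stub_coneExteriorEscape` from the flux line `stub_reflexFluxLine` + the wedge geometry `stub_reflexWedgeGeometry`;
  upper bound: `arcMass_le_of_arcPhases` from the flux line + the rigid arc-dart phases `stub_arcPhases`);
* **`marginalCell_rayMassDiff_le`** — `|Z₀ − Z₆₀ − sin(π/8)| ≤ 1 + √2` (the two ray masses, each growing like `log N`
  numerically, differ by a BOUNDED amount; `rayMassDiff_le_of_arcPhases`).

Numerically (exact enumeration `N ≤ 3`, SMC `N ≤ 32`, `Cruxes/HexConjecture/Lines/marginal_reflex_wedge_cauchy_kernel_numerics.md`):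
arc mass `1.06–1.11`, `Z₀ + Z₆₀ = 0.366·ln N`, `Z₀ − Z₆₀ → ≈ sin(π/8)`. CFT reading: corner weight `h(5π/3) = 3/8` plus
boundary weight `5/8` equals `1`, the weight of a current — the cell is marginal. No named fact is used (DCS Lemma 1,
winding rigidity and the Hopf evaluation are all proved in the tree).
-/

open scoped BigOperators Classical
open Literature.Probability.LatticeModels Literature.Probability.RandomPlanarGeometry
  Literature.Probability.RandomPlanarGeometry.SAW

namespace Summit.CriticalPhenomena.SAWScalingLimit.Theorems.HexConjecture.MarginalWedge

/-- **The dimensionless marginal cell (two-sided, unconditional).** For every truncation `W_N`, `N ≥ 1`, of the `300°`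
lattice wedge rooted at its corner mid-edge, the `x_c`-mass of self-avoiding walks from the corner to the arc darts lies
in `[cos(π/8), 1 + √2]`. Registered sub-goal `marginalCell_arcMass_mem_Icc` of the crux skeleton. -/
theorem marginalCell_arcMass_mem_Icc : ∀ (Λ : Finset HexVertex) (N : ℝ), 1 ≤ N → IsReflexWedgeTruncation Λ N → Real.cos (Real.pi / 8) ≤ (dartSum Λ (IsArcDart N) fun v w => Zm Λ cornerEdge s(v, w)) ∧ (dartSum Λ (IsArcDart N) fun v w => Zm Λ cornerEdge s(v, w)) ≤ 1 + Real.sqrt 2 := by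
  intro Λ N hN hΛ
  have hflux := stub_reflexFluxLine stub_reflexWedgeGeometry Λ N hN hΛ
  exact ⟨stub_coneExteriorEscape (stub_reflexFluxLine stub_reflexWedgeGeometry) Λ Λ N hN hΛ le_rfl,
    arcMass_le_of_arcPhases Λ N hflux (stub_arcPhases Λ N hN hΛ)⟩

/-- **The ray difference is bounded (unconditional).** For every `N ≥ 1`, `|Z₀^{(N)} − Z₆₀^{(N)} − sin(π/8)| ≤ 1 + √2`,
where `Z₀`, `Z₆₀` are the ray masses (`rayZeroMass`, `raySixtyMass`, sums of `‖F‖ = Z` over the two ray-dart families). -/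
theorem marginalCell_rayMassDiff_le : ∀ (Λ : Finset HexVertex) (N : ℝ), 1 ≤ N → IsReflexWedgeTruncation Λ N → |rayZeroMass Λ N - raySixtyMass Λ N - Real.sin (Real.pi / 8)| ≤ 1 + Real.sqrt 2 := by
  intro Λ N hN hΛ
  exact rayMassDiff_le_of_arcPhases Λ N (stub_reflexFluxLine stub_reflexWedgeGeometry Λ N hN hΛ)
    (stub_arcPhases Λ N hN hΛ)

end Summit.CriticalPhenomena.SAWScalingLimit.Theorems.HexConjecture.MarginalWedge
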